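import Literature.NumberTheory.EllipticCurves.CongruentNewformLevel32
import Literature.NumberTheory.EllipticCurves.CuspFormLFunctionFrickeProofs
import Literature.NumberTheory.DiophantineGeometry.DenesEquationWeightTwoLevelsProofs
import Literature.NumberTheory.DiophantineGeometry.DenesEquationFreyCurveTwoProofs
import Literature.NumberTheory.EllipticCurves.SzpiroOfAbcProofs
import Literature.NumberTheory.Automorphic.BCDTModularity
import HarnessLib

/-!
# The congruent number curve `E₁ : y² = x³ − x` is modular: `η(4z)²η(8z)²` is its newform

Topic `Literature/NumberTheory/EllipticCurves`; namespace
`Literature.NumberTheory.EllipticCurves.Tunnell1983` (the namespace of the tree's realisations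
`congruentCuspForm` / `congruentCuspForm32` of `φ = η(4z)²η(8z)²`).  Theorems only (no definition,
no named fact).

The tree already PROVES every analytic input of the classical statement "`φ = η(4z)²η(8z)² =
q − 2q⁵ − 3q⁹ + 6q¹³ + ⋯` is the newform of the conductor-`32` elliptic curve `y² = x³ − x`"
(Tunnell 1983, p. 325; Koblitz, *Introduction to Elliptic Curves and Modular Forms*, Ch. II §5–§6 and
Ch. IV; Darmon–Merel 1997 §4: "`X₀(32) : Y² = X³ − X`"):

* `congruentCuspForm32 : CuspForm (Γ₀(32)) 2` with function `φ` (`CongruentNewformLevel32`);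
* `aₙ(φ) = aₙ(E₁)` for ALL `n` (`cuspCoeff_congruentCuspForm_eq_lFunction`, `CongruentNewformCuspForm`,
  by Jacobi sums / Gaussian primary sums);
* `S₂(Γ₀(M)) = 0` for `M ∣ 16` and `dim S₂(Γ₀(32)) = 1` (`cuspForm_two_gamma0_eq_zero_of_dvd_sixteen`,
  `finrank_cuspForm_two_gamma0_thirtyTwo`, `DenesEquationWeightTwoLevelsProofs`, from the cuspidal
  Sturm bound and the genus of `X₀(32)`);
* the conductor of the Frey curve of the trivial solution `y² = x(x − 1)(x − 2) ≅ y² = x³ − x` is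
  `32` (`conductorNorm_freyCurve_denes_of_odd`, Tate's algorithm at `2`, type `III`, `f₂ = 5`).

Here we assemble them into the tree's modularity vocabulary (`IsNewform0`, `IsNewformOf`,
`BCDT.IsModular`), obtaining the FIRST unconditional instance of `BCDT.IsModular` in the tree:

* `congruentCuspForm32_mem_newSubspace0` — `φ` is new at level `32` (every adjoint degeneracy map
  lands in `S₂(Γ₀(M))`, `M ∣ 16`, which is `0`);
* `isHeckeEigenform_congruentCuspForm32` — `φ` is a Hecke eigenform (`T_p φ ∈ S₂(Γ₀(32)) = ℂ φ`);
* `isNewform0_congruentCuspForm32` — **`φ` is a newform on `Γ₀(32)`** (new, eigen, `a₁ = 1`);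
* `isNewformOf_congruentNumberCurve_one` — **`φ` is the newform of `E₁`** (`aₙ(φ) = aₙ(E₁)` ∀ `n`);
* `conductorNorm_congruentNumberCurve_one` — `N(E₁) = 32`;
* `isModular_congruentNumberCurve_one` — **`E₁` is modular in the sense of BCDT (2)**.

Deliberately NOT here: uniqueness of the newform in its isogeny class beyond level `32`
(`eq_of_isNewform0_thirtyTwo` is already in `DenesEquationSerreRoadProofs`), the quadratic twists
`E_m` (their newforms `φ ⊗ χ` live on `Γ₀(32m²)`, whose new subspaces the tree cannot yet pin), and
any Galois-representation statement.

## References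

* J. B. Tunnell, *A classical Diophantine problem and modular forms of weight 3/2*, Invent. Math. 72
  (1983), 323–334, p. 325. [Tunnell1983Congruent]
* H. Darmon, L. Merel, *Winding quotients and some variants of Fermat's Last Theorem*, J. reine
  angew. Math. 490 (1997), 81–100, §4 (p. 10). [DarmonMerel1997]
* C. Breuil, B. Conrad, F. Diamond, R. Taylor, J. Amer. Math. Soc. 14 (2001), 843–939,
  Introduction, condition (2). [BCDTJAMS2001]
-/

noncomputable section

open scoped MatrixGroups ModularForm
open CongruenceSubgroup

namespace Literature.NumberTheory.EllipticCurves.Tunnell1983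

open Literature.NumberTheory.EllipticCurves.ModularForms
open Literature.NumberTheory.DiophantineGeometry
open Literature.NumberTheory.Automorphic
open _root_.WeierstrassCurve

/-! ### `φ` is a newform on `Γ₀(32)` -/

/-- The Fourier coefficients of the level-`32` realisation of `φ` are those of the level-`64` one
(same function `φ`, same `q`-expansion). [folklore] -/
theorem cuspCoeff_congruentCuspForm32 (n : ℕ) :
    cuspCoeff congruentCuspForm32 n = cuspCoeff congruentCuspForm n := rfl

/-- **`aₙ(φ) = aₙ(E₁)` for all `n`**, for `φ` ON `Γ₀(32)` (`E₁ = congruentNumberCurve 1 : y² = x³ − x`;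
the tree's `cuspCoeff_congruentCuspForm_eq_lFunction`). [cite: Tunnell1983Congruent, p. 325] -/
theorem cuspCoeff_congruentCuspForm32_eq_lFunction (n : ℕ) :
    cuspCoeff congruentCuspForm32 n = ((congruentNumberCurve 1).LFunction n : ℂ) :=
  cuspCoeff_congruentCuspForm_eq_lFunction n

/-- `a₁(φ) = 1`: `φ` on `Γ₀(32)` is normalised. [folklore] -/
theorem isNormalized_congruentCuspForm32 : IsNormalized congruentCuspForm32 :=
  cuspCoeff_congruentCuspForm_one

/-- `φ ≠ 0` in `S₂(Γ₀(32))` (`a₁(φ) = 1`, while every coefficient of the zero form vanishes).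
[folklore] -/
theorem congruentCuspForm32_ne_zero : congruentCuspForm32 ≠ 0 := by
  intro h
  have h1 : cuspCoeff congruentCuspForm32 1 = 1 := isNormalized_congruentCuspForm32
  have h0 : cuspCoeff ((0 : ℂ) • congruentCuspForm32) 1 = 0 := by rw [cuspCoeff_smul, zero_mul]
  rw [zero_smul, ← h, h1] at h0
  exact one_ne_zero h0

/-- **`φ` is new at level `32`.**  The new subspace `S₂(Γ₀(32))^{new}` is the joint kernel of the
adjoint degeneracy maps `S₂(Γ₀(32)) → S₂(Γ₀(M))` over the proper divisors `M` of `32` (and `d` with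
`M d ∣ 32`); every such `M` divides `16`, and `S₂(Γ₀(M)) = 0` for `M ∣ 16`
(`cuspForm_two_gamma0_eq_zero_of_dvd_sixteen`: genus `0`), so every cusp form of level `32` — in
particular `φ` — is new (Atkin–Lehner: `S₂(Γ₀(32)) = S₂(Γ₀(32))^{new}`, there being no old forms).
[cite: DarmonMerel1997, §4 (first paragraph)] -/
theorem mem_newSubspace0_thirtyTwo (f : CuspForm (Gamma0 32) 2) : f ∈ newSubspace0 32 2 := by
  rw [newSubspace0, Submodule.mem_iInf]
  intro Md
  rw [LinearMap.mem_ker]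
  have hall : ∀ M ∈ Nat.properDivisors 32, M ∣ 16 := by decide
  exact cuspForm_two_gamma0_eq_zero_of_dvd_sixteen (hall _ Md.2.1) _

/-- `φ ∈ S₂(Γ₀(32))^{new}`. [cite: DarmonMerel1997, §4 (first paragraph)] -/
theorem congruentCuspForm32_mem_newSubspace0 : congruentCuspForm32 ∈ newSubspace0 32 2 :=
  mem_newSubspace0_thirtyTwo _

/-- **Every non-zero `f ∈ S₂(Γ₀(32))` is a Hecke eigenform**: `S₂(Γ₀(32))` is a line
(`finrank_cuspForm_two_gamma0_thirtyTwo`, the genus of `X₀(32)` being `1`) stable under every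
`T_p`, so `T_p f ∈ ℂ f`. [cite: DarmonMerel1997, §4 (first paragraph)] -/
theorem isHeckeEigenform_of_ne_zero_thirtyTwo {f : CuspForm (Gamma0 32) 2} (hf : f ≠ 0) :
    IsHeckeEigenform f := by
  intro p hp
  haveI : NeZero p := ⟨hp.ne_zero⟩
  obtain ⟨c, hc⟩ := (finrank_eq_one_iff_of_nonzero' f hf).mp finrank_cuspForm_two_gamma0_thirtyTwo
    (heckeT _ 2 p f)
  exact ⟨c, hc.symm⟩

/-- `φ` is a Hecke eigenform on `Γ₀(32)`. [cite: Tunnell1983Congruent, p. 325] -/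
theorem isHeckeEigenform_congruentCuspForm32 : IsHeckeEigenform congruentCuspForm32 :=
  isHeckeEigenform_of_ne_zero_thirtyTwo congruentCuspForm32_ne_zero

/-- **`φ = η(4z)²η(8z)²` is a newform of weight `2` on `Γ₀(32)`** (new, Hecke eigenform, `a₁ = 1`).
[cite: Tunnell1983Congruent, p. 325] -/
theorem isNewform0_congruentCuspForm32 : IsNewform0 congruentCuspForm32 :=
  ⟨congruentCuspForm32_mem_newSubspace0, isHeckeEigenform_congruentCuspForm32,
    isNormalized_congruentCuspForm32⟩

/-- **Uniqueness: every newform of weight `2` on `Γ₀(32)` is `φ`** (the line `S₂(Γ₀(32))` contains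
one normalised form). [cite: DarmonMerel1997, §4 (first paragraph)] -/
theorem eq_congruentCuspForm32_of_isNewform0 {g : CuspForm (Gamma0 32) 2} (hg : IsNewform0 g) :
    g = congruentCuspForm32 := by
  obtain ⟨c, hc⟩ := (finrank_eq_one_iff_of_nonzero' congruentCuspForm32
    congruentCuspForm32_ne_zero).mp finrank_cuspForm_two_gamma0_thirtyTwo g
  have h1 : cuspCoeff g 1 = 1 := hg.2.2
  have h2 : cuspCoeff congruentCuspForm32 1 = 1 := isNormalized_congruentCuspForm32
  have hc1 : c = 1 := by
    have h := congrArg (cuspCoeff · 1) hc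
    rw [cuspCoeff_smul, h1, h2, mul_one] at h
    exact h
  rw [← hc, hc1, one_smul]

/-! ### `φ` is the newform of `E₁ : y² = x³ − x`, and `E₁` is modular -/

/-- **`φ` is the newform attached to the congruent number curve `E₁ : y² = x³ − x`**:
`IsNewformOf E₁ φ` at level `32` — `φ` is a newform and `aₙ(φ) = aₙ(E₁)` for every `n`.
[cite: Tunnell1983Congruent, p. 325] -/
theorem isNewformOf_congruentNumberCurve_one :
    IsNewformOf (congruentNumberCurve 1) congruentCuspForm32 :=
  ⟨isNewform0_congruentCuspForm32, cuspCoeff_congruentCuspForm32_eq_lFunction⟩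

/-- `E₁ : y² = x³ − x` is the translate `x ↦ x + 1` of the Frey curve `y² = x(x − 1)(x − 2)` of the
trivial solution of `x + y = 2z` (the tree's `variableChange_freyCurve_trivial`). [folklore] -/
theorem congruentNumberCurve_one_eq_smul_freyCurve :
    congruentNumberCurve 1 = (⟨1, 1, 0, 0⟩ : VariableChange ℚ) • freyCurve 1 (-2) := by
  rw [variableChange_freyCurve_trivial]
  ext <;> simp [congruentNumberCurve]

/-- `E₁ : y² = x³ − x` is an elliptic curve (`Δ = 64 ≠ 0`); a theorem rather than a global
instance (use `haveI`). [folklore] -/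
theorem isElliptic_congruentNumberCurve_one : (congruentNumberCurve 1).IsElliptic := by
  rw [congruentNumberCurve_one_eq_smul_freyCurve]
  haveI := isElliptic_freyCurve_trivial
  infer_instance

/-- **`N(E₁) = 32`**: the conductor of `y² = x³ − x` is `32` (it is isomorphic to the Frey curve of
the trivial solution, whose conductor is `2⁵ · rad(1)` by Tate's algorithm at `2`, type `III`:
`conductorNorm_freyCurve_denes_of_odd`; the conductor is an isomorphism invariant,
`conductorNorm_smul_rat`). [cite: DarmonMerel1997, Prop. 1.1 (1)] -/
theorem conductorNorm_congruentNumberCurve_one : (congruentNumberCurve 1).conductorNorm ℤ = 32 := by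
  haveI := isElliptic_freyCurve_trivial
  rw [congruentNumberCurve_one_eq_smul_freyCurve, conductorNorm_smul_rat]
  have h := conductorNorm_freyCurve_denes_of_odd (p := 1) (a := 1) (b := 1) (c := 1) le_rfl
    (by norm_num) (by norm_num) isCoprime_one_left odd_one odd_one
  norm_num at h
  exact h

/-- `N(E₁) ≠ 0` (the instance under which `BCDT.IsModular E₁` is stated; a theorem, use `haveI`).
[folklore] -/
theorem neZero_conductorNorm_congruentNumberCurve_one :
    NeZero ((congruentNumberCurve 1).conductorNorm ℤ) :=
  ⟨by rw [conductorNorm_congruentNumberCurve_one]; norm_num⟩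

/-- **At every level `N = N(E₁)` there is a newform of `E₁`** (the level-polymorphic form of
modularity used by the summit files: `N(E₁) = 32` and `φ ∈ S₂(Γ₀(32))`). [cite: Tunnell1983Congruent, p. 325] -/
theorem exists_isNewformOf_congruentNumberCurve_one (N : ℕ) [NeZero N]
    (hN : (congruentNumberCurve 1).conductorNorm ℤ = N) :
    ∃ f : CuspForm (Gamma0 N) 2, IsNewformOf (congruentNumberCurve 1) f := by
  rw [conductorNorm_congruentNumberCurve_one] at hN
  subst hN
  exact ⟨congruentCuspForm32, isNewformOf_congruentNumberCurve_one⟩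

/-- **The congruent number curve `E₁ : y² = x³ − x` is modular** in the sense of
Breuil–Conrad–Diamond–Taylor, condition (2) (`BCDT.IsModular`: a newform `f ∈ S₂(Γ₀(N(E₁)))` with
`aₙ(f) = aₙ(E₁)` for all `n`), unconditionally: `f = φ = η(4z)²η(8z)²` at level `N(E₁) = 32`
(classically Hecke/Deuring for this CM curve; here from the tree's Jacobi-sum identity
`aₙ(φ) = aₙ(E₁)`).  The instance `NeZero (N(E₁))` is quantified, as in the tree's
`exists_isNewformOf`; it holds by `neZero_conductorNorm_congruentNumberCurve_one`.
[cite: BCDTJAMS2001, Introduction, condition (2)] -/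
theorem isModular_congruentNumberCurve_one [NeZero ((congruentNumberCurve 1).conductorNorm ℤ)] :
    BCDT.IsModular (congruentNumberCurve 1) :=
  exists_isNewformOf_congruentNumberCurve_one _ rfl

end Literature.NumberTheory.EllipticCurves.Tunnell1983

end
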